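import Summits.QuantumFields.YangMills.Theorems.BalabanUVNodesN10AtRecord11B13WalksRef
import Literature.MathematicalPhysics.QuantumFieldTheory.Balaban1983to89.B13NodeTorusWalksHolo

/-!
# BalabanUVNodes ∕ N10 AT NODE 00's [B13] GROUP OF RECORD, REFERENCE-RUNG EDITION WITHOUT THE TWO REGULARITY HYPOTHESES `hΨσ ∕ hΨτ`
# — the twin of `…N10AtRecord11B13WalksRef.b13LeafOfRecord_of_located_walksRef` (p467660) over the `hΨσ ∕ hΨτ`-free torus chain
# (`Literature/…/B13NodeTorusWalksHolo`, seat modules 11–15)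
# (Track A, DAG node N10 [B13]; FAN-OUT §N10 s3 lineage; seat `pub-ymgap-dag-n10-c` g2, module 16)

HONEST FRAMING.  Count-neutral kernel bookkeeping: exactly `N10AtRecord11B13WalksRef.b13LeafOfRecord_of_located_walksRef` (the [B13] leaf
`Node00.B13LeafOfRecord θ lam` at def-B13's objects of record `WtOfRecord θ lam` ∕ `c13OfRecord θ lam` from the Lemma 1–2 located inputs +
NODE A's REFERENCE rung on the terms of record + the dictionary + the numbers) with the two remaining [B13]-INTERNAL regularity hypotheses
of N10's Lemma-3 side REMOVED: `hΨσ ∕ hΨτ` — separate holomorphy in `σ(Z)` and `τ` of the (2.14) X-integral `core214`, an object internal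
to the proof (print p. 15: *"We consider it as an analytic function … of the complex parameters σ(Z), τ, and we estimate it using the
Cauchy formula"*; `B13Lemma3TorusSocket`: «analyticity: LOCATED-ROUTINE given the objects») — are now DERIVED (holomorphy under the integral
sign, cell `pub-balaban-gaps`' `B13Core214Holomorphic*` ∕ `B13Bound226LocatedPoly` through this seat's storeys `B13PrimitiveKernels216Holo`
p470482, `B13Lemma3TorusBindersHolo`, `B13NodeTorusTermwiseHolo`, `B13NodeTorusWalksHolo`) from KERNEL-LEVEL data a supplier of NODE A's rung
states anyway: the entries of `A(σ,u)`, `G(σ,u)` of every term are HOLOMORPHIC IN σ on an open polydisc containing the Cauchy contour (print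
p. 15: the quadratic forms are analytic functions of σ(Z) — here the open `e^{κ₁⁺}`-ball of a second constants record `cp`, `lam.c.κ₁ <
cp.κ₁`, at which NODE A's kernels `𝒦 Z t : TermKernels cp …` are tagged, so that the rung `TermWalksRef (𝒦 Z t) rf` and `hAs hlin` are asked
on that bigger polydisc — print's «much bigger analyticity space, constants α′₀, α′₁»), plus measurability of three objects of the LAYER in
the bond variables (`χ_{k,Y₀}`, the potentials `𝐕_k(Y,·)`, the small-field region `{B | emb B ∈ lam.sp1 Y ∀ Y ∈ 𝐃}` — (1.43) holds only
there; print never integrates outside because `χ_{k,Y₀}` vanishes, `hχsupp`).  PRICE: a Cauchy radius `r ≤ 1`, and print's letters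
`a₂₀ = m′α₄M⁻⁴(1+32∕(κ₁−1))⁴`, `w = K₀(64,8)α₄#(⋃𝐃)` DOUBLED inside `hαc ∕ hsmall ∕ hvol` ((2.20) on the open τ-discs of radii `2|τ(Y)|`;
print absorbs such factors in its `O(1)`∕`O(α₅)`).  REMOVED binders: `hΨσ hΨτ Uσ Uτ hUσ hUτ hUexp hUtau hsubτ hr'`; ADDED: `cp hκp hr1 hAhol
hGhol hχm hVm hsmallm`; everything else verbatim and in the same order, same conclusion `B13LeafOfRecord θ lam`.  WHAT REMAINS BY ASSERTION
for N10 after this file: NODE A's reference datum for Bałaban's kernels on the bigger polydisc with its σ-holomorphy and complex symmetry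
([13] Thms 3.10 ∕ 3.12, (2.5)–(2.9) — NODE A ∕ in-edge N06 ∕ the (D4) owner; NOT supplied), `hlin` (definitional), the dictionary `hT₃`, three
measurabilities; the Lemma 1–2 located inputs, the in-edges (1.24)∕(1.30), the numbers; the LAW layer for the layer's non-degeneracy
(vacuous at a layer with empty spaces).  N10 NOT discharged; nothing of Bałaban's asserted; one finite four-torus programme at fixed ε per
run; nothing continuum ∕ ℝ⁴ ∕ OS ∕ mass-gap ∕ Clay.  0 `sorry`, 0 `def`, standard axioms.  Filed `--supports` K1′ «StabilityBAtRecordR12e»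
(stmt-QuantumFields-19903, `--as helper`) of route «BalabanUVNodes» (rev 15).

WHAT THIS FILE PROVES.  §1 `b13LeafOfRecord_of_located_walksRefHolo` — by `exact B13NodeTorusWalksHolo.b13Leaf_twoTorus_walksRefHolo` at the
objects of record (faces `WtOfRecord_Vp ∕ _Vpp ∕ _rd ∕ _V ∕ _Q`, `rfl`, `ResidB13.analytic_add ∕ _zero`), termwise domination
`termDomination_WtOfRecord` ∘ `hT₃`, NODE O's exchange by `exchange_of_thresholds` on the standard rate book — as module 5 did for ₂.
-/

noncomputable section

namespace Summit.QuantumFields.YangMills.BalabanUVNodes.N10AtRecord11B13WalksRefHolo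

open Literature.MathematicalPhysics.QuantumFieldTheory.Balaban1983to89
open Literature.MathematicalPhysics.QuantumFieldTheory.Balaban1983to89.DagBinding
open Literature.MathematicalPhysics.QuantumFieldTheory.Balaban1983to89.Node00
open Literature.MathematicalPhysics.QuantumFieldTheory.Balaban1983to89.B13Lemma3Torus (TwoTorusStep)
open Literature.MathematicalPhysics.QuantumFieldTheory.Balaban1983to89.B13Lemma3TorusSocket (TermDomination Lemma3Numerics)
open Literature.MathematicalPhysics.QuantumFieldTheory.Balaban1983to89.B13Lemma3TorusData
open Metric
open Literature.MathematicalPhysics.QuantumFieldTheory.Balaban1983to89.B16Absorption (pbox)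
open Literature.MathematicalPhysics.QuantumFieldTheory.Balaban1983to89.TreeLengthTorus
open Literature.MathematicalPhysics.QuantumFieldTheory.Balaban1983to89.TreeLengthTorusGeometry
open Literature.MathematicalPhysics.QuantumFieldTheory.Balaban1983to89.TreeLengthTorusTransfer
open Literature.MathematicalPhysics.QuantumFieldTheory.Balaban1983to89.B12TreeDecay (kappa₀ K₀)
open Literature.MathematicalPhysics.QuantumFieldTheory.Balaban1983to89.B13PkScaling (Qop scaled)
open Literature.MathematicalPhysics.QuantumFieldTheory.Balaban1983to89.B13Bound143 (invTau R12)
open Literature.MathematicalPhysics.QuantumFieldTheory.Balaban1983to89.B13Term214 (term214 SepHolOn core214 F214)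
open Literature.MathematicalPhysics.QuantumFieldTheory.Balaban1983to89.B13Lemma3TorusTerms (terms Z0)
open Literature.MathematicalPhysics.QuantumFieldTheory.Balaban1983to89.B5TorusCover (UT)
open Literature.MathematicalPhysics.QuantumFieldTheory.Balaban1983to89.B13TermWalkData (TermKernels)
open Literature.MathematicalPhysics.QuantumFieldTheory.Balaban1983to89.NodeOLettersOfWalksAcross (WalkPackage TermWalks)
open Literature.MathematicalPhysics.QuantumFieldTheory.Balaban1983to89.NodeOLettersOfWalksPerturbative
  (RefPackage TermWalksRef termWalks_of_ref_thresholds)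
open Literature.MathematicalPhysics.QuantumFieldTheory.Balaban1983to89.NodeOLettersOfWalksAcross (WalkPackage)
open Literature.MathematicalPhysics.QuantumFieldTheory.Balaban1983to89.B13NodeTorusWalks (exchange_of_thresholds)
open Literature.MathematicalPhysics.QuantumFieldTheory.Balaban1983to89.B13NodeTorusWalksHolo (b13Leaf_twoTorus_walksRefHolo)
open scoped Matrix

/-! ## §1. THE REFERENCE-RUNG, `hΨσ ∕ hΨτ`-FREE EDITION OF THE JUNCTION AT THE GROUP OF RECORD (Stage 3) -/

section Group

variable (θ : Stage3Params) (lam : ResidB13 θ)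

open Classical in
/-- **THE [B13] LEAF AT NODE 00's GROUP OF RECORD FROM THE REFERENCE RUNG ON THE TERMS OF RECORD, WITHOUT `hΨσ ∕ hΨτ`.**  Exactly
`N10AtRecord11B13WalksRef.b13LeafOfRecord_of_located_walksRef` (same binders in the same order, same conclusion `B13LeafOfRecord θ lam`) except
the module header's trade: `hΨσ hΨτ Uσ Uτ hUσ hUτ hUexp hUtau hsubτ hr'` REMOVED; `(cp : B13.Consts) (hκp : lam.c.κ₁ < cp.κ₁)`, `hr1 : r ≤ 1`,
per-term `hAhol hGhol` (σ-holomorphy of NODE A's kernels on the open `e^{cp.κ₁}`-polydisc), `hχm hVm hsmallm` ADDED; `𝒦 Z t : TermKernels cp …`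
(rung and `hAs hlin` on the bigger polydisc); print's `a₂₀`, `w` DOUBLED in `hαc ∕ hsmall ∕ hvol`.
[cite: Balaban1988RG2Cluster, Lemma 1 p.9, Lemma 2 p.11, Lemma 3 p.20, p.13, p.15, (2.14)–(2.26) pp.15–17; Balaban1985BackgroundPropagators, Thm 3.10 p.416, Thm 3.12 p.423] -/
theorem b13LeafOfRecord_of_located_walksRefHolo
    (hN12 : 12 ≤ (θ.ℓ₆ + 1) * (lam.n + 1))
    -- (1) LEMMA 1: [I]'s block geometry of the (1.33) index families of the layer
    (dist : TDom 4 ((θ.ℓ₆ + 1) * (lam.n + 1)) → TPt 4 ((θ.ℓ₆ + 1) * (lam.n + 1)) → (j : ℕ) →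
      TPt 4 ((θ.ℓ₆ + 1) ^ (lam.k - j) * ((θ.ℓ₆ + 1) * (lam.n + 1))) → ℝ) {K K' : ℝ}
    (hS0Y : ∀ Y, ∀ a ∈ lam.S0 Y,
      (pbox (fun i => natLift a i - (5 : ℕ)) (fun i => natLift a i + 1 + (5 : ℕ))).image (proj ((θ.ℓ₆ + 1) * (lam.n + 1))) ⊆ Y.1)
    (hFsub : ∀ Y a, lam.F Y a ⊆
      (pbox (fun i => natLift a i - (5 : ℕ)) (fun i => natLift a i + 1 + (5 : ℕ))).image (proj ((θ.ℓ₆ + 1) * (lam.n + 1))) \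
        (pbox (fun i => natLift a i - (4 : ℕ)) (fun i => natLift a i + 1 + (4 : ℕ))).image (proj ((θ.ℓ₆ + 1) * (lam.n + 1))))
    (hSq : ∀ Y, ∀ a ∈ lam.S0 Y, ∀ j, lam.Sq Y a j ⊆
      (Finset.univ : Finset (TPt 4 ((θ.ℓ₆ + 1) ^ (lam.k - j) * ((θ.ℓ₆ + 1) * (lam.n + 1))))).filter
        (fun q => tcoarse ((θ.ℓ₆ + 1) ^ (lam.k - j)) ((θ.ℓ₆ + 1) * (lam.n + 1)) q ∈
          (pbox (fun i => natLift a i - (2 : ℕ)) (fun i => natLift a i + 1 + (2 : ℕ))).image (proj ((θ.ℓ₆ + 1) * (lam.n + 1)))))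
    (hScY : ∀ Y, lam.Sc Y ⊆ Y.1)
    (hdist0 : ∀ Y a j q, 0 ≤ lam.c.δ₀ * dist Y a j q)
    (hdist : ∀ Y a j (n : ℕ) q, q ∉ (pbox (fun i => (((θ.ℓ₆ + 1) ^ (lam.k - j) : ℕ) : ℤ) * natLift a i - (n + 1 : ℕ))
      (fun i => (((θ.ℓ₆ + 1) ^ (lam.k - j) : ℕ) : ℤ) * natLift a i + 2 * (((θ.ℓ₆ + 1) ^ (lam.k - j) : ℕ) : ℤ) - 1 + (n + 1 : ℕ))).image
        (proj ((θ.ℓ₆ + 1) ^ (lam.k - j) * ((θ.ℓ₆ + 1) * (lam.n + 1)))) → lam.c.δ₀ * lam.c.M * ((n : ℝ) + 1) ≤ lam.c.δ₀ * dist Y a j q)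
    (hSX : ∀ Y a j q, lam.SX Y a j q ⊆ (tcubeSys 4 ((θ.ℓ₆ + 1) ^ (lam.k - j) * ((θ.ℓ₆ + 1) * (lam.n + 1)))).above q)
    (hSX' : ∀ Y a j q, lam.SX' Y a j q ⊆ (tcubeSys 4 ((θ.ℓ₆ + 1) ^ (lam.k - j) * ((θ.ℓ₆ + 1) * (lam.n + 1)))).above q)
    (hX0 : ∀ Y, ∀ a ∈ lam.Sc Y, ∀ j ∈ Finset.range (lam.k + 1), ∀ q ∈ lam.Sq' Y a j, ∀ x ∈ lam.SX' Y a j q,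
      x.1.image (tcoarse ((θ.ℓ₆ + 1) ^ (lam.k - j)) ((θ.ℓ₆ + 1) * (lam.n + 1))) ⊆ Y.1)
    -- (1) LEMMA 1: per-term analyticity on (1.34)
    (hAnT : ∀ Y, ∀ a ∈ lam.S0 Y, ∀ X ∈ (lam.F Y a).powerset, ∀ j ∈ Finset.range (lam.k + 1), ∀ q ∈ lam.Sq Y a j,
      ∀ x ∈ lam.SX Y a j q, AnalyticOnNhd ℂ (lam.T Y a X j q x) (lam.sp1 Y))
    (hAnT' : ∀ Y, ∀ a ∈ lam.Sc Y, ∀ j ∈ Finset.range (lam.k + 1), ∀ q ∈ lam.Sq' Y a j, ∀ x ∈ lam.SX' Y a j q,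
      AnalyticOnNhd ℂ (lam.T' Y a j q x) (lam.sp1 Y))
    -- (1) LEMMA 1: thresholds and restrictions on the residual constants
    (hK : 0 ≤ K) (hK' : 0 ≤ K') (hκ : 0 ≤ lam.c.κ) (hδ1 : lam.c.δ < 1) (hδκ : 1 ≤ lam.c.δ * lam.c.κ)
    (hκ126 : kappa₀ 64 8 ≤ lam.c.κ) (hκ126' : kappa₀ 64 8 ≤ lam.c.δ * lam.c.κ)
    (hκ₁ : 1 + 2 * Real.log (8 * 12 ^ 3) ≤ lam.c.κ₁) (hκ₁' : 2 + 16 * Real.log 128 ≤ lam.c.κ₁)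
    (hδ₀M : 10 * Real.exp (-1) ≤ lam.c.δ₀ * lam.c.M) (hδ₀M5 : 2 * Real.log 5 ≤ lam.c.δ₀ * lam.c.M)
    (hR8 : (1 - lam.c.δ) * lam.c.κ ≤ (1 / 4) * (lam.c.κ₁ - 1)) (hR9 : (1 - 2 * lam.c.δ) * lam.c.κ ≤ (1 / 16) * lam.c.κ₁)
    -- (1) LEMMA 1: per-term (1.24), (1.30) by reference to [I] (3.54), (3.17), [15] Prop. 4, [13] (3.108); the constants with headroom (1 − θ₁)
    (h124 : ∀ Y φ, φ ∈ lam.sp1 Y → ∀ a ∈ lam.S0 Y, ∀ X ∈ (lam.F Y a).powerset, ∀ j ∈ Finset.range (lam.k + 1), ∀ q ∈ lam.Sq Y a j,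
      ∀ x ∈ lam.SX Y a j q,
        ‖lam.T Y a X j q x φ‖ ≤ K * (((θ.ℓ₆ + 1 : ℕ) : ℝ) ^ j * (((θ.ℓ₆ + 1 : ℕ) : ℝ) ^ lam.k)⁻¹) ^ 5 *
          Real.exp (-(lam.c.κ₁ - 1) *
            (((Y.1 \ (pbox (fun i => natLift a i - (5 : ℕ)) (fun i => natLift a i + 1 + (5 : ℕ))).image
              (proj ((θ.ℓ₆ + 1) * (lam.n + 1)))).card : ℝ) + X.card)) *
          Real.exp (-(lam.c.κ * torusTreeLen x.1)))
    (h130 : ∀ Y φ, φ ∈ lam.sp1 Y → ∀ a ∈ lam.Sc Y, ∀ j ∈ Finset.range (lam.k + 1), ∀ q ∈ lam.Sq' Y a j,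
      ∀ x ∈ lam.SX' Y a j q,
        ‖lam.T' Y a j q x φ‖ ≤ K' * Real.exp (-(1 / 2) * (lam.c.δ₀ * lam.c.M) * (((θ.ℓ₆ + 1 : ℕ) : ℝ) ^ j * (((θ.ℓ₆ + 1 : ℕ) : ℝ) ^ lam.k)⁻¹)⁻¹
            - (1 / 2) * lam.c.δ₀ * dist Y a j q) *
          Real.exp (-(lam.c.κ₁ - 1) * ((Y.1 \ x.1.image (tcoarse ((θ.ℓ₆ + 1) ^ (lam.k - j)) ((θ.ℓ₆ + 1) * (lam.n + 1)))).card : ℝ)) *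
          Real.exp (-(lam.c.κ * torusTreeLen x.1)))
    {θ₁ : ℝ} (hθ₁0 : 0 ≤ θ₁) (hθ₁1 : θ₁ < 1)
    (hC : K * K₀ 64 8 * (2 * (6 * ((θ.ℓ₆ + 1 : ℕ) : ℝ)) ^ 4) * Real.exp 1 * Real.exp ((1 / 8) * lam.c.κ₁ * (12 ^ 4 - 1)) +
        2 * (64 * K') * K₀ 64 8 * 1344 ≤
      (1 - θ₁) * (lam.c.E₀ * lam.c.ε₁ * lam.c.C₁ * lam.c.M ^ lam.c.q * Real.exp (lam.c.C₂ * lam.c.κ₁)))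
    -- (2) LEMMA 2 (pp. 10–11): the curvature terms; the located per-term data of `B13Lemma2Torus.lemma2Printed_twoTorus'` for the layer's plaquette data
    (hGlAn : ∀ Y, AnalyticOnNhd ℂ (lam.Gl Y) (lam.sp1 Y))
    (hGl : ∀ Y φ, φ ∈ lam.sp1 Y → ‖lam.Gl Y φ‖ ≤ θ₁ * (lam.c.E₀ * lam.c.ε₁ * lam.c.C₁ * lam.c.M ^ lam.c.q * Real.exp (lam.c.C₂ * lam.c.κ₁)) *
      Real.exp (-((1 - 2 * lam.c.δ) * lam.c.κ * (tsys 4 ((θ.ℓ₆ + 1) * (lam.n + 1))).dj Y)))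
    (he : ∀ Y b, ‖lam.e Y b‖ ≤ 1) (hg : lam.g ≠ 0)
    {R K₂ : ℝ} {m₂ : ℕ} (hK₂ : 0 ≤ K₂) (hR : 0 < R) (hε3 : 3 * lam.c.ε₁ ≤ R)
    (hW : ∀ Y, ∀ i ∈ lam.s Y, ∀ φ ∈ lam.sp1 Y, AnalyticOnNhd ℂ (lam.Wf Y i φ) (ball 0 R))
    (hKW : ∀ Y, ∀ i ∈ lam.s Y, ∀ φ ∈ lam.sp1 Y, ∀ z ∈ ball (0 : lam.E) R,
      ‖lam.Wf Y i φ z‖ ≤ K₂ * Real.exp (-(lam.c.κ₁ - 1) * ((Y.1.card : ℝ) - 1)) * ‖z‖ ^ 3)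
    (hcard : ∀ Y, (lam.s Y).card ≤ m₂ * Y.1.card)
    (hsp : ∀ Y φ, φ ∈ lam.sp1 Y → ‖lam.g‖ * ‖lam.rd Y φ‖ < lam.c.ε₁)
    (hfloor : 27 * m₂ * K₂ * Real.exp (lam.c.κ₁ - 1) ≤ lam.c.C₃ * lam.c.M ^ 4 * Real.exp (lam.c.C₂ * lam.c.κ₁))
    (hAnP : ∀ Y, ∀ i ∈ lam.s Y, AnalyticOnNhd ℂ (fun φ => scaled lam.g (lam.Wf Y i φ) (lam.rd Y φ)) (lam.sp1 Y))
    (hG : ∀ Y, lam.GaugeInv (lam.V Y) ∧ lam.GaugeInv ((WtOfRecord θ lam).toStepData.quadForm Y) ∧ lam.GaugeInv (lam.Vpp Y))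
    -- (3) LEMMA 3 (pp. 14–20): the signs of (2.18)–(2.20), R12, |τ(Y)| ≥ 2, and the numerics bundle at ℓ = ½L
    (hL8 : 8 ≤ θ.ℓ₆ + 1) {a a₂ a₂' a₅ Aabs : ℝ} (hN : Lemma3Numerics (c13OfRecord θ lam) (lam.m₃ + 1) (((θ.ℓ₆ + 1 : ℕ) : ℝ) / 2) a a₂ a₂' a₅ Aabs)
    (h12 : R12 (c13OfRecord θ lam)) (hE : 0 < lam.c.E₀) (hε : 0 < lam.c.ε₁) (hC₁ : 0 < lam.c.C₁) (hα : 0 < lam.c.α₄)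
    (hM : 1 ≤ lam.c.M)
    (hτ2 : lam.c.E₀ * lam.c.ε₁ * lam.c.C₁ * lam.c.α₄⁻¹ * lam.c.M ^ lam.c.q * Real.exp (lam.c.C₂ * lam.c.κ₁) ≤ 1 / 2)
    -- (3) the Cauchy radius and the parameter domains (p. 15)
    -- the bigger σ-polydisc (a second constants record `cp` lending its `κ₁`; NODE A's kernels are tagged at `cp`) and a
    -- Cauchy radius `r ≤ 1`; the τ-regions are the open discs of radii `2|τ(Y)|` (chosen inside)
    (cp : B13.Consts) (hκp : lam.c.κ₁ < cp.κ₁) {r : ℝ} (hr : 0 < r) (hr1 : r ≤ 1)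
    -- (3) THE DICTIONARY: per term (𝐃, P) of every Z ∈ 𝐃_{k+1}, the kernel data `𝒦 Z t` on a site torus `UT Nf` with
    --     configuration space `E₃`, and the configuration `u = uOf Z t φ` of `φ ∈ sp2 Z`, of size ≤ α
    {ν : ℕ} {Nf : Fin ν → ℕ} [∀ i, NeZero (Nf i)]
    {E₃ : Type*} [NormedAddCommGroup E₃] [NormedSpace ℂ E₃]
    (𝒦 : TDom 4 (lam.n + 1) → Finset (TDom 4 ((θ.ℓ₆ + 1) * (lam.n + 1))) × Finset (TBond 4 (lam.m₃ + 1) ((θ.ℓ₆ + 1) * (lam.n + 1))) → TermKernels cp 4 (lam.n + 1) ν Nf E₃)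
    [∀ Z t, Fintype (𝒦 Z t).C₀] [∀ Z t, DecidableEq (𝒦 Z t).C₀]
    (uOf : (Z : TDom 4 (lam.n + 1)) → (t : Finset (TDom 4 ((θ.ℓ₆ + 1) * (lam.n + 1))) × Finset (TBond 4 (lam.m₃ + 1) ((θ.ℓ₆ + 1) * (lam.n + 1)))) → lam.Φ → E₃)
    {α : ℝ} (hαnn : 0 ≤ α) (huα : ∀ Z, ∀ t ∈ terms (θ.ℓ₆ + 1) (lam.m₃ + 1) Z, ∀ φ ∈ lam.sp2 Z, ‖uOf Z t φ‖ ≤ α)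
    -- (3) per term: parameter lists, the linear map Γ(σ), characteristic functions, potentials
    (lZ : TDom 4 (lam.n + 1) → Finset (TDom 4 ((θ.ℓ₆ + 1) * (lam.n + 1))) × Finset (TBond 4 (lam.m₃ + 1) ((θ.ℓ₆ + 1) * (lam.n + 1))) → List (TPt 4 (lam.n + 1)))
    (hlZ : ∀ Z, ∀ t ∈ terms (θ.ℓ₆ + 1) (lam.m₃ + 1) Z, (lZ Z t).Nodup ∧ (lZ Z t).toFinset = Z.1 \ tclosure (θ.ℓ₆ + 1) (lam.n + 1) (Z0 (lam.m₃ + 1) t))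
    (lD : TDom 4 (lam.n + 1) → Finset (TDom 4 ((θ.ℓ₆ + 1) * (lam.n + 1))) × Finset (TBond 4 (lam.m₃ + 1) ((θ.ℓ₆ + 1) * (lam.n + 1))) → List (TDom 4 ((θ.ℓ₆ + 1) * (lam.n + 1))))
    (hlD : ∀ Z, ∀ t ∈ terms (θ.ℓ₆ + 1) (lam.m₃ + 1) Z, (lD Z t).Nodup ∧ (lD Z t).toFinset = t.1)
    (Γm : (Z : TDom 4 (lam.n + 1)) → (t : Finset (TDom 4 ((θ.ℓ₆ + 1) * (lam.n + 1))) × Finset (TBond 4 (lam.m₃ + 1) ((θ.ℓ₆ + 1) * (lam.n + 1)))) → lam.Φ →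
      (TPt 4 (lam.n + 1) → ℂ) → ((𝒦 Z t).Λ ⊕ (𝒦 Z t).C₀ → ℝ) → ((𝒦 Z t).Λ → ℂ))
    (χY₀ χcP : (Z : TDom 4 (lam.n + 1)) → (t : Finset (TDom 4 ((θ.ℓ₆ + 1) * (lam.n + 1))) × Finset (TBond 4 (lam.m₃ + 1) ((θ.ℓ₆ + 1) * (lam.n + 1)))) →
      ((𝒦 Z t).Λ → ℝ) → ℝ)
    (hχ0 : ∀ Z t B, 0 ≤ χY₀ Z t B) (hχ1 : ∀ Z t B, χY₀ Z t B ≤ 1)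
    (Pl : (Z : TDom 4 (lam.n + 1)) → (t : Finset (TDom 4 ((θ.ℓ₆ + 1) * (lam.n + 1))) × Finset (TBond 4 (lam.m₃ + 1) ((θ.ℓ₆ + 1) * (lam.n + 1)))) → Finset (𝒦 Z t).Λ)
    (hPcard : ∀ Z, ∀ t ∈ terms (θ.ℓ₆ + 1) (lam.m₃ + 1) Z, (Pl Z t).card = t.2.card) {rP : ℝ} (hrP : 0 ≤ rP)
    (hχc : ∀ Z t B, χcP Z t B = ∏ b ∈ Pl Z t, (if rP ≤ |B b| then (1 : ℝ) else 0))
    (Dfam : TDom 4 (lam.n + 1) → Finset (TDom 4 ((θ.ℓ₆ + 1) * (lam.n + 1))) × Finset (TBond 4 (lam.m₃ + 1) ((θ.ℓ₆ + 1) * (lam.n + 1))) → Finset (TDom 4 ((θ.ℓ₆ + 1) * (lam.n + 1))))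
    (Vr : (Z : TDom 4 (lam.n + 1)) → (t : Finset (TDom 4 ((θ.ℓ₆ + 1) * (lam.n + 1))) × Finset (TBond 4 (lam.m₃ + 1) ((θ.ℓ₆ + 1) * (lam.n + 1)))) → lam.Φ →
      TDom 4 ((θ.ℓ₆ + 1) * (lam.n + 1)) → ((𝒦 Z t).Λ → ℝ) → ℂ)
    -- (3) THE LAYER's TERM IS (dominated by) THE (2.14) X-INTEGRAL OF NODE A's KERNELS at the configuration — the
    --     dictionary identification; termwise domination of H(Z) = Σ T₃ is then the theorem `termDomination_WtOfRecord`
    (hT₃ : ∀ Z, ∀ t ∈ terms (θ.ℓ₆ + 1) (lam.m₃ + 1) Z, ∀ φ ∈ lam.sp2 Z, ‖lam.T₃ Z t φ‖ ≤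
      ‖term214 r (lZ Z t) (lD Z t)
        (core214 (fun σ => (𝒦 Z t).A2 σ (uOf Z t φ)) (Γm Z t φ)
          (F214 t.2.card (χY₀ Z t) (χcP Z t) (Dfam Z t) (Vr Z t φ))) 0 0‖)
    -- (3) the record's objects behind the terms: bonds, cubes, the real field inside the configurations
    (ιb : (Z : TDom 4 (lam.n + 1)) → (t : Finset (TDom 4 ((θ.ℓ₆ + 1) * (lam.n + 1))) × Finset (TBond 4 (lam.m₃ + 1) ((θ.ℓ₆ + 1) * (lam.n + 1)))) → (𝒦 Z t).Λ → lam.Bond)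
    (hι : ∀ Z t, Function.Injective (ιb Z t)) (cube : lam.Bond → TPt 4 ((θ.ℓ₆ + 1) * (lam.n + 1)))
    (hQsupp : ∀ (Y : TDom 4 ((θ.ℓ₆ + 1) * (lam.n + 1))) φ b b', lam.Q Y φ b b' ≠ 0 → cube b ∈ Y.1 ∧ cube b' ∈ Y.1)
    {m' : ℕ} (hfibc : ∀ Z t (x : TPt 4 ((θ.ℓ₆ + 1) * (lam.n + 1))), (Finset.univ.filter fun j => cube (ιb Z t j) = x).card ≤ m')
    (emb : (Z : TDom 4 (lam.n + 1)) → (t : Finset (TDom 4 ((θ.ℓ₆ + 1) * (lam.n + 1))) × Finset (TBond 4 (lam.m₃ + 1) ((θ.ℓ₆ + 1) * (lam.n + 1)))) → lam.Φ →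
      ((𝒦 Z t).Λ → ℝ) → lam.Φ)
    (hBv : ∀ Z t φ B b, lam.Bv (emb Z t φ B) (ιb Z t b) = (B b : ℂ))
    (hBv0 : ∀ Z t φ B b', b' ∉ Set.range (ιb Z t) → lam.Bv (emb Z t φ B) b' = 0)
    (hVr : ∀ Z, ∀ t ∈ terms (θ.ℓ₆ + 1) (lam.m₃ + 1) Z, ∀ φ ∈ lam.sp2 Z, ∀ Y ∈ Dfam Z t, ∀ B,
      emb Z t φ B ∈ lam.sp1 Y → Vr Z t φ Y B = lam.V Y (emb Z t φ B))
    (hχsupp : ∀ Z, ∀ t ∈ terms (θ.ℓ₆ + 1) (lam.m₃ + 1) Z, ∀ φ ∈ lam.sp2 Z, ∀ B, χY₀ Z t B ≠ 0 → ∀ Y ∈ Dfam Z t,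
      emb Z t φ B ∈ lam.sp1 Y)
    -- (3) REPLACES the separate holomorphy `hΨσ ∕ hΨτ` of the X-integral: NODE A's kernels entrywise HOLOMORPHIC IN σ on the
    --     open `e^{κ₁⁺}`-polydisc at the configuration, and measurability of the layer's `χ_{k,Y₀}`, potentials, small-field region
    (hAhol : ∀ Z, ∀ t ∈ terms (θ.ℓ₆ + 1) (lam.m₃ + 1) Z, ∀ φ ∈ lam.sp2 Z, ∀ i j,
      DifferentiableOn ℂ (fun σ => (𝒦 Z t).A2 σ (uOf Z t φ) i j) {σ : TPt 4 (lam.n + 1) → ℂ | ∀ j, σ j ∈ Metric.ball (0 : ℂ) (Real.exp cp.κ₁)})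
    (hGhol : ∀ Z, ∀ t ∈ terms (θ.ℓ₆ + 1) (lam.m₃ + 1) Z, ∀ φ ∈ lam.sp2 Z, ∀ i j,
      DifferentiableOn ℂ (fun σ => (𝒦 Z t).G2 σ (uOf Z t φ) i j) {σ : TPt 4 (lam.n + 1) → ℂ | ∀ j, σ j ∈ Metric.ball (0 : ℂ) (Real.exp cp.κ₁)})
    (hχm : ∀ Z t, Measurable (χY₀ Z t)) (hVm : ∀ Z t φ Y, Measurable (Vr Z t φ Y))
    (hsmallm : ∀ Z t φ, MeasurableSet {B : (𝒦 Z t).Λ → ℝ | ∀ Y ∈ Dfam Z t, emb Z t φ B ∈ lam.sp1 Y})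
    -- (3) NODE A's structural inputs at the configuration: A(σ) COMPLEX SYMMETRIC on the polydisc; Γ(σ) = G(σ)·
    --     (`Re A(σ) ≻ 0` is no longer asked: it follows from the rung's m_A-accretivity, `re_posDef_of_termWalks`)
    (hAs : ∀ Z, ∀ t ∈ terms (θ.ℓ₆ + 1) (lam.m₃ + 1) Z, ∀ φ ∈ lam.sp2 Z, ∀ σ : TPt 4 (lam.n + 1) → ℂ, (∀ j, ‖σ j‖ ≤ Real.exp cp.κ₁) →
      ((𝒦 Z t).A2 σ (uOf Z t φ)).IsSymm)
    (hlin : ∀ Z, ∀ t ∈ terms (θ.ℓ₆ + 1) (lam.m₃ + 1) Z, ∀ φ ∈ lam.sp2 Z, ∀ σ : TPt 4 (lam.n + 1) → ℂ, (∀ j, ‖σ j‖ ≤ Real.exp cp.κ₁) →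
      ∀ X : (𝒦 Z t).Λ ⊕ (𝒦 Z t).C₀ → ℝ, Γm Z t φ σ X = (𝒦 Z t).G2 σ (uOf Z t φ) *ᵥ fun j => (X j : ℂ))
    {γ₂ : ℝ} (hγ₂ : 0 ≤ γ₂)
    -- (3) uniform fibre bounds of the bond locations
    {m : ℕ}
    (hfibΛ : ∀ Z t (x : UT Nf), (Finset.univ.filter fun i => (𝒦 Z t).locΛ i = x).card ≤ m)
    (hfibN : ∀ Z t (x : UT Nf), (Finset.univ.filter fun j => (𝒦 Z t).locN j = x).card ≤ m)
    -- (3) THE REFERENCE RUNG ON THE TERMS OF THE STEP OF RECORD (the displayed hypothesis, n10-b's reference currency):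
    --     ONE admissible reference package `rf`, an accretivity radius `0 < R₁ < R`, print's two perturbative sources (p. 15:
    --     «O(1)e^{−⅓δ₀M} + O(α₀ + α₁)» against the reference positivity) as FOUR DIVISION-FREE THRESHOLDS, positive input
    --     rates and `η ≤ etaMax` of the W-walks package `rf.toWalkPackage R₁` (standard rate book: `κ_C = κ_C⋆`, `ρ′ = μ∕4`),
    --     `TermWalksRef` for the kernels of every term, round letters, and PRINT's TWO EXCHANGE THRESHOLDS for a `θ₀ > 0`
    (rf : RefPackage) (hrf : rf.Admissible) {R₁ : ℝ} (hR₁ : 0 < R₁) (hR₁R : R₁ < rf.R)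
    (hPσ : 8 * rf.KbarP * rf.cV₀ * Real.exp (-(rf.εP * rf.Rσ)) ≤ rf.m₀) (hP₁ : 8 * rf.KbarP * rf.cV₀ * R₁ ≤ rf.m₀ * rf.R)
    (hAσ : 8 * rf.KbarA * rf.cV * Real.exp (-(rf.εA * rf.Rσ)) ≤ rf.mA₀) (hA₁ : 8 * rf.KbarA * rf.cV * R₁ ≤ rf.mA₀ * rf.R)
    (hp : (rf.toWalkPackage R₁).PositiveRates) (hη : rf.η ≤ (rf.toWalkPackage R₁).etaMax) (hαR : α < R₁)
    (hwalks : ∀ Z, ∀ t ∈ terms (θ.ℓ₆ + 1) (lam.m₃ + 1) Z, TermWalksRef (𝒦 Z t) rf)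
    {KG KCs θ₀ : ℝ} (hKG : (rf.toWalkPackage R₁).Kbar ≤ KG) (hKCs : 8 / rf.mA₀ ≤ KCs) (hθ₀ : 0 < θ₀)
    (hαsmall : α ≤ θ₀ * R₁ / (4 * (rf.toWalkPackage R₁).Kbar + 4))
    (hRσlarge : Real.log ((4 * (rf.toWalkPackage R₁).Kbar + 4) / θ₀)
      / ((rf.toWalkPackage R₁).mu / 4 - (rf.toWalkPackage R₁).kapCStar) ≤ rf.Rσ)
    -- (3) rates below the package's κ_C⋆, and NODE A's letter ϑ (θ_Γ = θ_E = θ₀, K_Γ = K_G, K₀′ = K_Cs, θ_C derived)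
    {kap kap' kap'' kap₂ ϑ : ℝ} (hkap'' : 0 < kap'') (hk1 : kap'' < kap') (hk2 : kap' < kap) (hk3 : kap < kap₂)
    (hk4 : kap₂ < (rf.toWalkPackage R₁).kapCStar) (hθ₀le : θ₀ ≤ ϑ)
    (hθR1le : (m * (1 + 2 / (kap - kap')) ^ ν) * (m * (1 + 2 / (kap' - kap'')) ^ ν)
      * (θ₀ * KCs * KG
        + KG * (KCs * θ₀ * (m * (1 + 2 / ((rf.toWalkPackage R₁).kapCStar - kap₂)) ^ ν) * KCs * (m * (1 + 2 / (kap₂ - kap)) ^ ν)) * KG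
        + KG * KCs * θ₀) ≤ ϑ)
    (hsmallKθ : KCs * (m * (1 + 2 / kap) ^ ν) * (ϑ * (m * (1 + 2 / kap'') ^ ν)) < 1)
    -- (3) the (2.24)–(2.25) smallness with `a₂₀ = 2·m′·α₄·M⁻⁴(1 + 32/(κ₁−1))⁴`; the eigenvalue bound of C is the NUMBER
    --     `2∕m_{A,0} ≤ cE`; the form bound of Γ₀ is the NUMBER `g = B_Γ²c_V·m c₀(1,η)^ν∕(m_{A,0}∕2)`
    {cE : ℝ} (hc0 : 0 ≤ cE)
    (hcE : 2 / rf.mA₀ ≤ cE)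
    (hαc : (2 * (ϑ * (m * (1 + 2 / kap'') ^ ν)) +
      (γ₂ + 2 * (m' * lam.c.α₄ * (lam.c.M ^ 4)⁻¹ * (1 + 32 / (lam.c.κ₁ - 1)) ^ 4))) * cE ≤ 1 / 2)
    (hsmall : (2 * (ϑ * (m * (1 + 2 / kap'') ^ ν)) +
      (γ₂ + 2 * (m' * lam.c.α₄ * (lam.c.M ^ 4)⁻¹ * (1 + 32 / (lam.c.κ₁ - 1)) ^ 4))) * (1 + 2 * cE * (((rf.toWalkPackage R₁).BΓ * rf.cV) * ((rf.toWalkPackage R₁).BΓ * (m * B6.c0 1 rf.η ^ ν)) / (rf.mA₀ / 2))) ≤ 1 / 2)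
    -- (3) constant matching, p. 17: `a ≤ γ₂ r_P²` and the volume factor with `w = 2·K₀(64,8)·α₄·#(⋃𝐃)`
    (hPa : a ≤ γ₂ * rP ^ 2)
    (hvol : ∀ Z, ∀ t ∈ terms (θ.ℓ₆ + 1) (lam.m₃ + 1) Z,
      2 * (KCs * (m * (1 + 2 / kap) ^ ν) * (ϑ * (m * (1 + 2 / kap'') ^ ν))
              * (1 + (1 - KCs * (m * (1 + 2 / kap) ^ ν) * (ϑ * (m * (1 + 2 / kap'') ^ ν)))⁻¹) / 2)
          * (Fintype.card (𝒦 Z t).Λ : ℝ)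
        + 2 * (K₀ 64 8 * lam.c.α₄ * ((((Dfam Z t).image Subtype.val).biUnion id).card : ℝ))
        + (2 * (ϑ * (m * (1 + 2 / kap'') ^ ν)) +
            (γ₂ + 2 * (m' * lam.c.α₄ * (lam.c.M ^ 4)⁻¹ * (1 + 32 / (lam.c.κ₁ - 1)) ^ 4))) * cE * (Fintype.card (𝒦 Z t).Λ : ℝ)
        + (2 * (ϑ * (m * (1 + 2 / kap'') ^ ν)) +
            (γ₂ + 2 * (m' * lam.c.α₄ * (lam.c.M ^ 4)⁻¹ * (1 + 32 / (lam.c.κ₁ - 1)) ^ 4))) * (1 + 2 * cE * (((rf.toWalkPackage R₁).BΓ * rf.cV) * ((rf.toWalkPackage R₁).BΓ * (m * B6.c0 1 rf.η ^ ν)) / (rf.mA₀ / 2)))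
            * (Fintype.card ((𝒦 Z t).Λ ⊕ (𝒦 Z t).C₀) : ℝ)
        ≤ a₅ * ((Z.1).card : ℝ)) :
    B13LeafOfRecord θ lam := by
  -- the W-walks package of the reference package, its standard rate book, print's two thresholds ⇒ NODE O's exchange inequality
  have hq : (rf.toWalkPackage R₁).Admissible := RefPackage.admissible_toWalkPackage hrf hR₁
  have hpos := WalkPackage.stdRates_pos (rf.toWalkPackage R₁) hq hp hη
  have hθ : 2 * (rf.toWalkPackage R₁).Kbar *
      (Real.exp (-((((rf.toWalkPackage R₁).stdRates hq hp hη).ρ' - ((rf.toWalkPackage R₁).stdRates hq hp hη).κC) *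
        (rf.toWalkPackage R₁).Rσ)) + α / (rf.toWalkPackage R₁).R) ≤ θ₀ :=
    exchange_of_thresholds hq ((rf.toWalkPackage R₁).stdRates hq hp hη) hpos.2.1 hθ₀ hαsmall hRσlarge
  -- termwise domination at the step of record (H = Σ T₃, `termDomination_WtOfRecord`) chained with the dictionary `hT₃`
  have hH : ∀ (Z : TDom 4 (lam.n + 1)) (φ : lam.Φ), φ ∈ lam.sp2 Z → ‖(WtOfRecord θ lam).H Z φ‖ ≤
      ∑ t ∈ terms (θ.ℓ₆ + 1) (lam.m₃ + 1) Z, ‖term214 r (lZ Z t) (lD Z t)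
        (core214 (fun σ => (𝒦 Z t).A2 σ (uOf Z t φ)) (Γm Z t φ)
          (F214 t.2.card (χY₀ Z t) (χcP Z t) (Dfam Z t) (Vr Z t φ))) 0 0‖ := fun Z φ hφ =>
    (termDomination_WtOfRecord lam Z φ hφ).trans (Finset.sum_le_sum fun t ht => hT₃ Z t ht φ hφ)
  exact b13Leaf_twoTorus_walksRefHolo (WtOfRecord θ lam) (c13OfRecord θ lam) lam.k hN12 hL8 rfl lam.S0 lam.F lam.Sq lam.SX
    lam.T lam.Sc lam.Sq' lam.SX' lam.T' dist (WtOfRecord_Vp lam) hS0Y hFsub hSq hScY hdist0 hdist hSX hSX' hX0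
    (fun _ _ _ hf hg => lam.analytic_add hf hg) lam.analytic_zero hAnT hAnT' hK hK' hκ hδ1 hδκ hκ126 hκ126' hκ₁ hκ₁'
    hδ₀M hδ₀M5 hR8 hR9 h124 h130 hθ₁0 hθ₁1 hC lam.Gl (WtOfRecord_Vpp lam) hGlAn hGl lam.rd lam.e he (WtOfRecord_rd lam)
    lam.s lam.Wf hg hK₂ hR hε3 hW hKW hcard (WtOfRecord_V lam) (fun Y φ b b' _ => WtOfRecord_Q lam Y φ b b') hsp
    (fun _ => rfl) hfloor hAnP hG (lam.m₃ + 1) hN h12 hE hε hC₁ hα hM hτ2 cp hκp hr hr1 𝒦 uOf hαnn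
    huα lZ hlZ lD hlD Γm χY₀ χcP hχ0 hχ1 Pl hPcard hrP hχc Dfam Vr hH ιb hι cube hQsupp hfibc emb hBv hBv0 hVr hχsupp
    hAhol hGhol hχm hVm hsmallm hAs hlin hγ₂ hfibΛ hfibN rf hrf hR₁ hR₁R hPσ hP₁ hAσ hA₁ hp hη
    ((rf.toWalkPackage R₁).stdRates hq hp hη) hpos.1 hpos.2.1.le hαR hwalks hKG hKCs hθ hkap'' hk1
    hk2 hk3 hk4 hθ₀le hθR1le hsmallKθ hc0 hcE hαc hsmall hPa hvol

end Group

end Summit.QuantumFields.YangMills.BalabanUVNodes.N10AtRecord11B13WalksRefHolo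

end
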